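import Mathlib
import Summits.Ventures.PercRepro2.HCovCovariance
import Summits.Ventures.PercRepro2.A3Fibre

/-!
# The conditional expectation given the revealed cluster `C(a₃)` is the fibre mean (blind cell
PercRepro2, typer-1 g16; p5 g12's `A3Fibre.lean`; the lead's word 2026-08-26T19:57:57Z — part I)

Reveal the cluster `W₃ = C(a₃)` and let `𝒢 = σ(C(a₃))` be the σ-algebra it generates
(`clusterSigma`, the comap of the `Finset`-valued cluster map `clusterMap`).  For a conditioning
event `A` the conditional expectation of `f` given `𝒢` under `μ[|A]` (`μ = percMeasureOf p hp`, the
product Bernoulli measure of the measure bridge) is the fibre average `condMean p ends a₃ A f`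
(`E[1_{A ∩ {C = W}} f] / P(A ∩ {C = W})` on `{C = W}`, `0` on a null fibre):
**`condMean_ae_eq_condExp`**, by the defining property of `condExp`
(`ae_eq_condExp_of_forall_setIntegral_eq`) on the finite configuration space — the set integrals over
the `𝒢`-measurable sets `{C(a₃) ∈ t}` agree (`expect_indicator_preimage_condMean`), and the fibre
mean is `𝒢`-measurable (`condMean_measurable`).  The fibre sums of the products and of the means of
`condMean` (`expect_indicator_condMean_mul`, `expect_indicator_condMean`) are what part II
(`A3BetweenCovariance.lean`) expands the covariances into.
-/

namespace Summit.Ventures.PercRepro2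

open UnionCluster MeasureTheory ProbabilityTheory MeasureBridge

namespace CovForm

namespace A3Means

/-! ## The revealed cluster, its σ-algebra, and the fibre means -/

section Defs

variable {V : Type*} {E : Type*} [Fintype V] [DecidableEq V] [Fintype E] [DecidableEq E]

/-- The revealed cluster `C(a₃)` as a `Finset`-valued map on configurations. -/
noncomputable def clusterMap (ends : E → Sym2 V) (a₃ : V) : Config E → Finset V :=
  fun ω => A3Fibre.clusterFinset ends ω a₃

/-- `𝒢 = σ(C(a₃))`: the σ-algebra generated by the revealed cluster of `a₃`. -/
@[reducible] noncomputable def clusterSigma (ends : E → Sym2 V) (a₃ : V) : MeasurableSpace (Config E) :=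
  MeasurableSpace.comap (clusterMap ends a₃) ⊤

/-- The mass of `f` on the `A`-fibre `A ∩ {C(a₃) = W}`. -/
noncomputable def fibreExpect (p : E → ℝ) (ends : E → Sym2 V) (a₃ : V) (A : Set (Config E))
    (f : Config E → ℝ) (W : Finset V) : ℝ :=
  expect p (fun ω => (A ∩ clusterEvent ends a₃ (↑W : Set V)).indicator 1 ω * f ω)

/-- The conditional mean of `f` on the `A`-fibre `W` (`0` on a null fibre, Lean's `x / 0 = 0`). -/
noncomputable def fibreMean (p : E → ℝ) (ends : E → Sym2 V) (a₃ : V) (A : Set (Config E))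
    (f : Config E → ℝ) (W : Finset V) : ℝ :=
  fibreExpect p ends a₃ A f W / prob p (A ∩ clusterEvent ends a₃ (↑W : Set V))

/-- The conditional mean of `f` given the revealed cluster under the conditioning `A`: the fibre
mean of the fibre of `ω`. -/
noncomputable def condMean (p : E → ℝ) (ends : E → Sym2 V) (a₃ : V) (A : Set (Config E))
    (f : Config E → ℝ) : Config E → ℝ :=
  fun ω => fibreMean p ends a₃ A f (clusterMap ends a₃ ω)

end Defs

/-! ## The fibres as sets -/

section Sets

variable {V : Type*} {E : Type*} [Fintype V] [DecidableEq V] [Fintype E] [DecidableEq E]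

omit [DecidableEq E] in
/-- `ω ∈ {C(a₃) = W}` iff the cluster map of `ω` is `W`. -/
lemma mem_clusterEvent_iff_clusterMap_eq {ends : E → Sym2 V} {a₃ : V} {W : Finset V}
    {ω : Config E} : ω ∈ clusterEvent ends a₃ (↑W : Set V) ↔ clusterMap ends a₃ ω = W := by
  rw [mem_clusterEvent, ← A3Fibre.coe_clusterFinset ends ω a₃, Finset.coe_inj]
  exact Iff.rfl

omit [Fintype V] [DecidableEq V] [Fintype E] [DecidableEq E] in
/-- Membership in a `Q`-fibre: `a₁ ↮ a₂` and `C(a₃) = W`. -/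
lemma mem_fibre_iff {ends : E → Sym2 V} {a₁ a₂ a₃ : V} {W : Finset V} {ω : Config E} :
    ω ∈ A3Fibre.fibre ends a₁ a₂ a₃ W ↔
      ¬ Conn ends ω a₂ a₁ ∧ cluster ends ω a₃ = (↑W : Set V) := by
  simp only [A3Fibre.fibre, Set.mem_inter_iff, mem_avoidAll, Finset.mem_singleton, forall_eq,
    mem_clusterEvent]

omit [Fintype V] [DecidableEq V] [Fintype E] [DecidableEq E] in
/-- On `{C(a₃) = W}`, `v ∈ W` iff `a₃ ↔ v`. -/
lemma mem_W_iff_conn {ends : E → Sym2 V} {a₃ v : V} {W : Finset V} {ω : Config E}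
    (hW : cluster ends ω a₃ = (↑W : Set V)) : v ∈ W ↔ Conn ends ω a₃ v := by
  rw [← Finset.mem_coe, ← hW, mem_cluster]

omit [Fintype V] [Fintype E] [DecidableEq E] in
/-- On the `Q`-fibre `W` the world sign `σ₃` is the constant `s3 W`. -/
lemma sigma_a3_eq_s3 {ends : E → Sym2 V} {a₁ a₂ a₃ : V} {W : Finset V} {ω : Config E}
    (hω : ω ∈ A3Fibre.fibre ends a₁ a₂ a₃ W) :
    sigma (R := ℝ) ends a₁ a₂ a₃ ω = A3Fibre.s3 (R := ℝ) a₁ a₂ W := by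
  obtain ⟨hQ, hW⟩ := mem_fibre_iff.1 hω
  have h1 : Conn ends ω a₁ a₃ ↔ a₁ ∈ W := by
    rw [mem_W_iff_conn (v := a₁) hW]
    exact ⟨conn_symm, conn_symm⟩
  have h2 : Conn ends ω a₂ a₃ ↔ a₂ ∈ W := by
    rw [mem_W_iff_conn (v := a₂) hW]
    exact ⟨conn_symm, conn_symm⟩
  have h12 : ¬ (a₁ ∈ W ∧ a₂ ∈ W) :=
    fun h => hQ (conn_trans (h2.2 h.2) (conn_symm (h1.2 h.1)))
  simp only [sigma, iL, iH]
  by_cases ha₁ : a₁ ∈ W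
  · by_cases ha₂ : a₂ ∈ W
    · exact absurd ⟨ha₁, ha₂⟩ h12
    · have c1 : ω ∈ connEvent ends a₁ a₃ := h1.2 ha₁
      have c2 : ω ∉ connEvent ends a₂ a₃ := fun h => ha₂ (h2.1 h)
      rw [Set.indicator_of_mem c1, Set.indicator_of_notMem c2]
      simp [A3Fibre.s3, ha₁]
  · by_cases ha₂ : a₂ ∈ W
    · have c1 : ω ∉ connEvent ends a₁ a₃ := fun h => ha₁ (h1.1 h)
      have c2 : ω ∈ connEvent ends a₂ a₃ := h2.2 ha₂
      rw [Set.indicator_of_notMem c1, Set.indicator_of_mem c2]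
      simp [A3Fibre.s3, ha₁, ha₂]
    · have c1 : ω ∉ connEvent ends a₁ a₃ := fun h => ha₁ (h1.1 h)
      have c2 : ω ∉ connEvent ends a₂ a₃ := fun h => ha₂ (h2.1 h)
      rw [Set.indicator_of_notMem c1, Set.indicator_of_notMem c2]
      simp [A3Fibre.s3, ha₁, ha₂]

omit [Fintype V] [DecidableEq V] [Fintype E] [DecidableEq E] in
/-- `PD ∩ {C(a₃) = W}` is the `Q`-fibre `W` when both roots are outside `W`. -/
lemma PD_inter_clusterEvent_of_notMem {ends : E → Sym2 V} {a₁ a₂ a₃ : V} {W : Finset V}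
    (h₁ : a₁ ∉ W) (h₂ : a₂ ∉ W) :
    PDEvent ends a₁ a₂ a₃ ∩ clusterEvent ends a₃ (↑W : Set V) = A3Fibre.fibre ends a₁ a₂ a₃ W := by
  ext ω
  simp only [A3Fibre.fibre, PDEvent, Dtilde, Set.mem_inter_iff, Set.mem_compl_iff, mem_connEvent,
    mem_inU, not_or, mem_avoidAll, Finset.mem_singleton, forall_eq, mem_clusterEvent]
  constructor
  · rintro ⟨⟨h12, -, -⟩, hW⟩
    exact ⟨fun h => h12 (conn_symm h), hW⟩
  · rintro ⟨hQ, hW⟩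
    refine ⟨⟨fun h => hQ (conn_symm h), ?_, ?_⟩, hW⟩
    · intro h
      exact h₁ ((mem_W_iff_conn (v := a₁) hW).2 h)
    · intro h
      exact h₂ ((mem_W_iff_conn (v := a₂) hW).2 h)

omit [Fintype V] [DecidableEq V] [Fintype E] [DecidableEq E] in
/-- `PD ∩ {C(a₃) = W}` is empty when a root lies in `W`. -/
lemma PD_inter_clusterEvent_eq_empty {ends : E → Sym2 V} {a₁ a₂ a₃ : V} {W : Finset V}
    (h : ¬ (a₁ ∉ W ∧ a₂ ∉ W)) :
    PDEvent ends a₁ a₂ a₃ ∩ clusterEvent ends a₃ (↑W : Set V) = ∅ := by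
  ext ω
  simp only [PDEvent, Dtilde, Set.mem_inter_iff, Set.mem_compl_iff, mem_connEvent, mem_inU,
    not_or, mem_clusterEvent, Set.mem_empty_iff_false, iff_false]
  rintro ⟨⟨-, h1, h2⟩, hW⟩
  apply h
  exact ⟨fun hm => h1 ((mem_W_iff_conn (v := a₁) hW).1 hm),
    fun hm => h2 ((mem_W_iff_conn (v := a₂) hW).1 hm)⟩

end Sets

/-! ## Fibre sums -/

section Sums

variable {V : Type*} {E : Type*} [Fintype V] [DecidableEq V] [Fintype E] [DecidableEq E]

/-- Partition of an expectation along the revealed cluster. -/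
lemma expect_eq_sum_clusters (p : E → ℝ) (ends : E → Sym2 V) (a₃ : V) (h : Config E → ℝ) :
    expect p h =
      ∑ W : Finset V, expect p (fun ω => (clusterEvent ends a₃ (↑W : Set V)).indicator 1 ω * h ω) := by
  unfold expect
  rw [Finset.sum_comm]
  refine Finset.sum_congr rfl fun ω _ => ?_
  rw [← Finset.mul_sum]
  congr 1
  conv_lhs => rw [← A3Fibre.sum_indicator_clusterEvent ends a₃ ω (h ω)]
  refine Finset.sum_congr rfl fun W _ => ?_
  by_cases hW : ω ∈ clusterEvent ends a₃ (↑W : Set V)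
  · simp [Set.indicator_of_mem hW]
  · simp [Set.indicator_of_notMem hW]

omit [Fintype V] [DecidableEq V] in
/-- On a null event every mass vanishes: `E[1_B f] = 0` when `P(B) = 0`. -/
lemma expect_indicator_mul_eq_zero {p : E → ℝ} (hp : IsProbVec p) {B : Set (Config E)}
    (hB : prob p B = 0) (f : Config E → ℝ) :
    expect p (fun ω => B.indicator 1 ω * f ω) = 0 := by
  have h0 : ∀ ω, B.indicator (weight p) ω = 0 := by
    intro ω
    have hsum : ∑ ω, B.indicator (weight p) ω = 0 := hB
    exact (Finset.sum_eq_zero_iff_of_nonneg fun ω _ =>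
      Set.indicator_apply_nonneg fun _ => weight_nonneg hp ω).1 hsum ω (Finset.mem_univ ω)
  unfold expect
  refine Finset.sum_eq_zero fun ω _ => ?_
  by_cases hω : ω ∈ B
  · have := h0 ω
    rw [Set.indicator_of_mem hω] at this
    simp only [Set.indicator_of_mem hω, Pi.one_apply, this, zero_mul]
  · simp only [Set.indicator_of_notMem hω, zero_mul, mul_zero]

omit [Fintype V] [DecidableEq V] in
/-- `E[a + c b] = E[a] + c E[b]`. -/
lemma expect_add_const_mul (p : E → ℝ) (a b : Config E → ℝ) (c : ℝ) :
    expect p (fun ω => a ω + c * b ω) = expect p a + c * expect p b := by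
  unfold expect
  rw [Finset.mul_sum, ← Finset.sum_add_distrib]
  exact Finset.sum_congr rfl fun ω _ => by ring

/-- On `{C(a₃) = W}` the conditional mean is the fibre mean of `W`. -/
lemma condMean_of_mem (p : E → ℝ) (ends : E → Sym2 V) (a₃ : V) (A : Set (Config E))
    (f : Config E → ℝ) {W : Finset V} {ω : Config E}
    (hW : ω ∈ clusterEvent ends a₃ (↑W : Set V)) :
    condMean p ends a₃ A f ω = fibreMean p ends a₃ A f W := by
  unfold condMean
  rw [mem_clusterEvent_iff_clusterMap_eq.1 hW]

/-- `E[1_A · E[f|𝒢] · E[g|𝒢]]` as the fibre sum `∑_W E_W[f] E_W[g] / P(A ∩ {C = W})`. -/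
lemma expect_indicator_condMean_mul (p : E → ℝ) (ends : E → Sym2 V) (a₃ : V)
    (A : Set (Config E)) (f g : Config E → ℝ) :
    expect p (fun ω => A.indicator 1 ω * (condMean p ends a₃ A f ω * condMean p ends a₃ A g ω)) =
      ∑ W : Finset V, fibreExpect p ends a₃ A f W * fibreExpect p ends a₃ A g W /
        prob p (A ∩ clusterEvent ends a₃ (↑W : Set V)) := by
  rw [expect_eq_sum_clusters p ends a₃]
  refine Finset.sum_congr rfl fun W _ => ?_
  have h1 : (fun ω => (clusterEvent ends a₃ (↑W : Set V)).indicator 1 ω *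
      (A.indicator 1 ω * (condMean p ends a₃ A f ω * condMean p ends a₃ A g ω))) =
      fun ω => (fibreMean p ends a₃ A f W * fibreMean p ends a₃ A g W) *
        (A ∩ clusterEvent ends a₃ (↑W : Set V)).indicator 1 ω := by
    funext ω
    by_cases hW : ω ∈ clusterEvent ends a₃ (↑W : Set V)
    · rw [condMean_of_mem p ends a₃ A f hW, condMean_of_mem p ends a₃ A g hW]
      by_cases hA : ω ∈ A
      · have hAW : ω ∈ A ∩ clusterEvent ends a₃ (↑W : Set V) := ⟨hA, hW⟩
        simp [Set.indicator_of_mem hW, Set.indicator_of_mem hA, Set.indicator_of_mem hAW]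
      · have hAW : ω ∉ A ∩ clusterEvent ends a₃ (↑W : Set V) := fun h => hA h.1
        simp [Set.indicator_of_notMem hA, Set.indicator_of_notMem hAW]
    · have hAW : ω ∉ A ∩ clusterEvent ends a₃ (↑W : Set V) := fun h => hW h.2
      simp [Set.indicator_of_notMem hW, Set.indicator_of_notMem hAW]
  rw [h1, expect_const_mul, expect_ind1]
  unfold fibreMean
  by_cases hP : prob p (A ∩ clusterEvent ends a₃ (↑W : Set V)) = 0
  · rw [hP]
    simp
  · field_simp

/-- `E[1_A · E[f|𝒢]] = ∑_W E_W[f]` (the fibre masses; a null fibre contributes `0`). -/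
lemma expect_indicator_condMean {p : E → ℝ} (hp : IsProbVec p) (ends : E → Sym2 V) (a₃ : V)
    (A : Set (Config E)) (f : Config E → ℝ) :
    expect p (fun ω => A.indicator 1 ω * condMean p ends a₃ A f ω) =
      ∑ W : Finset V, fibreExpect p ends a₃ A f W := by
  rw [expect_eq_sum_clusters p ends a₃]
  refine Finset.sum_congr rfl fun W _ => ?_
  have h1 : (fun ω => (clusterEvent ends a₃ (↑W : Set V)).indicator 1 ω *
      (A.indicator 1 ω * condMean p ends a₃ A f ω)) =
      fun ω => fibreMean p ends a₃ A f W * (A ∩ clusterEvent ends a₃ (↑W : Set V)).indicator 1 ω := by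
    funext ω
    by_cases hW : ω ∈ clusterEvent ends a₃ (↑W : Set V)
    · rw [condMean_of_mem p ends a₃ A f hW]
      by_cases hA : ω ∈ A
      · have hAW : ω ∈ A ∩ clusterEvent ends a₃ (↑W : Set V) := ⟨hA, hW⟩
        simp [Set.indicator_of_mem hW, Set.indicator_of_mem hA, Set.indicator_of_mem hAW]
      · have hAW : ω ∉ A ∩ clusterEvent ends a₃ (↑W : Set V) := fun h => hA h.1
        simp [Set.indicator_of_notMem hA, Set.indicator_of_notMem hAW]
    · have hAW : ω ∉ A ∩ clusterEvent ends a₃ (↑W : Set V) := fun h => hW h.2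
      simp [Set.indicator_of_notMem hW, Set.indicator_of_notMem hAW]
  rw [h1, expect_const_mul, expect_ind1]
  unfold fibreMean
  by_cases hP : prob p (A ∩ clusterEvent ends a₃ (↑W : Set V)) = 0
  · rw [hP, div_zero, zero_mul]
    exact (expect_indicator_mul_eq_zero hp hP f).symm
  · exact div_mul_cancel₀ _ hP

/-- The defining identity of the conditional expectation on every `𝒢`-measurable set
`{C(a₃) ∈ t}`: `E[1_A 1_{C ∈ t} E[f|𝒢]] = E[1_A 1_{C ∈ t} f]`. -/
lemma expect_indicator_preimage_condMean {p : E → ℝ} (hp : IsProbVec p) (ends : E → Sym2 V)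
    (a₃ : V) (A : Set (Config E)) (f : Config E → ℝ) (t : Set (Finset V)) :
    expect p (fun ω => A.indicator 1 ω *
        (clusterMap ends a₃ ⁻¹' t).indicator (condMean p ends a₃ A f) ω) =
      expect p (fun ω => A.indicator 1 ω * (clusterMap ends a₃ ⁻¹' t).indicator f ω) := by
  rw [expect_eq_sum_clusters p ends a₃, expect_eq_sum_clusters p ends a₃
    (fun ω => A.indicator 1 ω * (clusterMap ends a₃ ⁻¹' t).indicator f ω)]
  refine Finset.sum_congr rfl fun W _ => ?_
  have h1 : (fun ω => (clusterEvent ends a₃ (↑W : Set V)).indicator 1 ω *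
      (A.indicator 1 ω * (clusterMap ends a₃ ⁻¹' t).indicator (condMean p ends a₃ A f) ω)) =
      fun ω => t.indicator (fibreMean p ends a₃ A f) W *
        (A ∩ clusterEvent ends a₃ (↑W : Set V)).indicator 1 ω := by
    funext ω
    by_cases hW : ω ∈ clusterEvent ends a₃ (↑W : Set V)
    · have hc : clusterMap ends a₃ ω = W := mem_clusterEvent_iff_clusterMap_eq.1 hW
      by_cases hA : ω ∈ A
      · have hAW : ω ∈ A ∩ clusterEvent ends a₃ (↑W : Set V) := ⟨hA, hW⟩
        by_cases ht : W ∈ t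
        · have hpre : ω ∈ clusterMap ends a₃ ⁻¹' t := by
            rw [Set.mem_preimage, hc]
            exact ht
          simp [Set.indicator_of_mem hW, Set.indicator_of_mem hA, Set.indicator_of_mem hAW,
            Set.indicator_of_mem hpre, Set.indicator_of_mem ht, condMean, hc]
        · have hpre : ω ∉ clusterMap ends a₃ ⁻¹' t := by
            rw [Set.mem_preimage, hc]
            exact ht
          simp [Set.indicator_of_notMem hpre, Set.indicator_of_notMem ht]
      · have hAW : ω ∉ A ∩ clusterEvent ends a₃ (↑W : Set V) := fun h => hA h.1
        simp [Set.indicator_of_notMem hA, Set.indicator_of_notMem hAW]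
    · have hAW : ω ∉ A ∩ clusterEvent ends a₃ (↑W : Set V) := fun h => hW h.2
      simp [Set.indicator_of_notMem hW, Set.indicator_of_notMem hAW]
  have h2 : (fun ω => (clusterEvent ends a₃ (↑W : Set V)).indicator 1 ω *
      (A.indicator 1 ω * (clusterMap ends a₃ ⁻¹' t).indicator f ω)) =
      fun ω => t.indicator 1 W * ((A ∩ clusterEvent ends a₃ (↑W : Set V)).indicator 1 ω * f ω) := by
    funext ω
    by_cases hW : ω ∈ clusterEvent ends a₃ (↑W : Set V)
    · have hc : clusterMap ends a₃ ω = W := mem_clusterEvent_iff_clusterMap_eq.1 hW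
      by_cases hA : ω ∈ A
      · have hAW : ω ∈ A ∩ clusterEvent ends a₃ (↑W : Set V) := ⟨hA, hW⟩
        by_cases ht : W ∈ t
        · have hpre : ω ∈ clusterMap ends a₃ ⁻¹' t := by
            rw [Set.mem_preimage, hc]
            exact ht
          simp [Set.indicator_of_mem hW, Set.indicator_of_mem hA, Set.indicator_of_mem hAW,
            Set.indicator_of_mem hpre, Set.indicator_of_mem ht]
        · have hpre : ω ∉ clusterMap ends a₃ ⁻¹' t := by
            rw [Set.mem_preimage, hc]
            exact ht
          simp [Set.indicator_of_notMem hpre, Set.indicator_of_notMem ht]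
      · have hAW : ω ∉ A ∩ clusterEvent ends a₃ (↑W : Set V) := fun h => hA h.1
        simp [Set.indicator_of_notMem hA, Set.indicator_of_notMem hAW]
    · have hAW : ω ∉ A ∩ clusterEvent ends a₃ (↑W : Set V) := fun h => hW h.2
      simp [Set.indicator_of_notMem hW, Set.indicator_of_notMem hAW]
  rw [h1, h2, expect_const_mul, expect_const_mul, expect_ind1]
  by_cases ht : W ∈ t
  · rw [Set.indicator_of_mem ht, Set.indicator_of_mem ht, Pi.one_apply, one_mul]
    unfold fibreMean fibreExpect
    by_cases hP : prob p (A ∩ clusterEvent ends a₃ (↑W : Set V)) = 0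
    · rw [hP, div_zero, zero_mul]
      exact (expect_indicator_mul_eq_zero hp hP f).symm
    · exact div_mul_cancel₀ _ hP
  · rw [Set.indicator_of_notMem ht, Set.indicator_of_notMem ht, zero_mul, zero_mul]

end Sums

/-! ## The conditional expectation given the revealed cluster -/

section CondExp

variable {V : Type*} {E : Type*} [Fintype V] [DecidableEq V] [Fintype E] [DecidableEq E]

omit [DecidableEq V] [DecidableEq E] in
/-- `𝒢` is a sub-σ-algebra of the (discrete) configuration space. -/
lemma clusterSigma_le (ends : E → Sym2 V) (a₃ : V) :
    clusterSigma ends a₃ ≤ (inferInstance : MeasurableSpace (Config E)) :=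
  fun _ _ => MeasurableSet.of_discrete

omit [DecidableEq V] in
/-- The conditional mean is `𝒢`-measurable (a function of the revealed cluster). -/
lemma condMean_measurable (p : E → ℝ) (ends : E → Sym2 V) (a₃ : V) (A : Set (Config E))
    (f : Config E → ℝ) : Measurable[clusterSigma ends a₃] (condMean p ends a₃ A f) := by
  have h1 : @Measurable (Config E) (Finset V) (clusterSigma ends a₃) ⊤ (clusterMap ends a₃) :=
    measurable_iff_comap_le.mpr le_rfl
  have h2 : @Measurable (Finset V) ℝ ⊤ _ (fibreMean p ends a₃ A f) := measurable_from_top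
  exact h2.comp h1

/-- **The conditional expectation given the revealed cluster is the fibre mean**:
`μ[|A][f | 𝒢] = condMean p ends a₃ A f` a.e. under `μ[|A]` (vacuous for a null `A`). -/
theorem condMean_ae_eq_condExp (p : E → ℝ) (hp : IsProbVec p) (ends : E → Sym2 V) (a₃ : V)
    (A : Set (Config E)) (f : Config E → ℝ) :
    condMean p ends a₃ A f =ᵐ[(percMeasureOf p hp)[|A]]
      ((percMeasureOf p hp)[|A])[f | clusterSigma ends a₃] := by
  refine ae_eq_condExp_of_forall_setIntegral_eq (clusterSigma_le ends a₃) Integrable.of_finite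
    (fun _ _ _ => Integrable.integrableOn Integrable.of_finite) (fun s hs _ => ?_)
    (condMean_measurable p ends a₃ A f).stronglyMeasurable.aestronglyMeasurable
  obtain ⟨t, -, rfl⟩ := hs
  rw [← integral_indicator MeasurableSet.of_discrete, ← integral_indicator MeasurableSet.of_discrete,
    integral_cond_percMeasureOf, integral_cond_percMeasureOf]
  congr 1
  exact expect_indicator_preimage_condMean hp ends a₃ A f t

end CondExp

end A3Means

end CovForm

end Summit.Ventures.PercRepro2
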